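import Summits.BirchSwinnertonDyer.BirchSwinnertonDyer.Theorems.ErratumRoadFiveNonSurjCornerBranchesDefs
import HarnessLib

/-!
# Route `ErratumRoadFive` (rung K2), crux 6 `NonSurjCorner` (item stmt-BirchSwinnertonDyer-19065), child Jₚᶜ
# `NonSurjCornerKolyJ`: the branch is VACUOUS at the pairs with `p ∤ ∏_ℓ c_ℓ(E/ℚ)` (`t = 0`) — the BC3 stub
# `stub_kolyJ_tamZero` of the child's birth kit, PROVED (cell `bsd-stepL`, seat `bsd-stepL-corner-p1` g6;
# `--supports stmt-BirchSwinnertonDyer-19065`)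

The Jetchev branch asks, for every `s ≤ t := ord_p ∏_ℓ c_ℓ(E/ℚ)` and every Kolyvagin–Heegner datum `d` of square-free
conductor `n` over Kolyvagin primes of index `≥ s`, that the derived point be `p^s`-divisible: `PDiv d p s`. When
`p ∤ ∏_ℓ c_ℓ(E/ℚ)` (t = 0) the only level is `s = 0` and `PDiv d p 0` holds with the witness `Q = P_n` (`p⁰ • Q = Q`):
the branch carries content only at `t ≥ 1` — every corner pair that is SPLIT at `p` (`p ∣ c_p = ord_p Δ_min`) and the
non-split pairs with a `p` in some other Tamagawa number (census corner57: 39 of 64 pairs at `p = 5`, HOME/corner/g3).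
So the child's BC3 skeleton is `stub_kolyJ_tamZero` (this file, closed) + `stub_kolyJ_tamPos` (`p ∣ ∏ c`, the content).

* `Koly.pdiv_zero` — `PDiv d p 0` for every datum (witness the derived point itself).
* `nonSurjCornerKolyJ_of_not_dvd_tamagawa` — the text of `Theorems.NonSurjCornerKolyJ` with the extra hypothesis
  `¬ p ∣ W.tamagawaProduct`, PROVED (then `padicValNat p (∏ c) = 0`, so `s = 0`).

HONEST FRAMING: two elementary theorems (no definition, no named fact, no `sorry`); nothing asserted about any curve
with `p ∣ ∏ c`; nothing booked; item 19065 does not close; BSD is not advanced; no census word moves (T7).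
PARTITION (D-0054): X11b@p≥5 (B9 ∕ N8) × T4′ corner × {p ∤ ∏c} — types-the-object-of (child Jₚᶜ, t = 0 slice); closes none.

References: [McCallumLMS1991] §5 (p. 303) (`p^M ∣ P_n`); [Jetchev2008] Conj. 1.3 (shape); tree `X11b/Three/KolyvaginLine.lean` (`PDiv`).
-/

set_option autoImplicit false
set_option linter.dupNamespace false

noncomputable section

open scoped Classical NumberField

namespace Summit.BirchSwinnertonDyer.Rank1Residual.X11b.Three.Koly

open WeierstrassCurve Literature.NumberTheory.EllipticCurves Literature.NumberTheory.EllipticCurves.ModularForms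

/-- **`PDiv d p 0` always holds**: `p⁰ • P_n = P_n`, so the derived point is its own witness.
[cite: McCallumLMS1991, §5 (p. 303) (definition of p^M ∣ P_n)] -/
theorem pdiv_zero {N : ℕ} [NeZero N] {W : WeierstrassCurve ℚ} {K : Type} [Field K] [NumberField K]
    {Dt : ModularParametrizationData W N} {β : ℤ} {ι : K →+* ℂ} {n : ℕ} (d : KolyvaginHeegnerData Dt β ι n)
    (p : ℕ) : PDiv d p 0 :=
  ⟨d.derivedPoint, by rw [pow_zero, Nat.cast_one, one_smul]⟩

end Summit.BirchSwinnertonDyer.Rank1Residual.X11b.Three.Koly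

namespace Summit.BirchSwinnertonDyer.BirchSwinnertonDyer.Theorems

open CongruenceSubgroup WeierstrassCurve NumberField IsDedekindDomain Field
  Literature.NumberTheory.EllipticCurves
  Literature.NumberTheory.EllipticCurves.ModularForms
  Literature.NumberTheory.EllipticCurves.Rank1Residual
  Literature.NumberTheory.QuadraticFields.Quadratic
  Summit.BirchSwinnertonDyer.Rank1Residual
  Summit.BirchSwinnertonDyer.Rank1Residual.X11b.Three.Koly

/-- **The Jetchev branch `NonSurjCornerKolyJ` is vacuous at the pairs with `p ∤ ∏_ℓ c_ℓ(E/ℚ)`** (`t = 0`; BC3 stub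
`stub_kolyJ_tamZero` of the child's birth kit): its text verbatim with the extra hypothesis `¬ p ∣ W.tamagawaProduct`;
then `padicValNat p (∏ c) = 0`, the only level is `s = 0`, and `PDiv d p 0` is `Koly.pdiv_zero`. Elementary; asserts
nothing at `t ≥ 1`. [cite: Jetchev2008, Conj. 1.3 (shape only; nothing asserted)] [cite: McCallumLMS1991, §5 (p. 303)] -/
theorem nonSurjCornerKolyJ_of_not_dvd_tamagawa :
    ∀ (W : WeierstrassCurve ℚ) [W.IsElliptic] [W.IsGloballyMinimal] [NeZero (W.conductorNorm ℤ)]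
      (p : ℕ) [Fact p.Prime] (K : Type) [Field K] [NumberField K]
      (Dt : ModularParametrizationData W (W.conductorNorm ℤ)) (β : ℤ) (ι : K →+* ℂ),
      ¬ p ∣ W.tamagawaProduct →
      ClassX11b W p → ¬ Surj W p → (p = 5 ∨ p = 7) → p ∣ padicValInt p W.minimalDiscriminantInt →
      ¬ Ram W p → IsImaginaryQuadratic K → 4 < (NumberField.discr K).natAbs →
      SatisfiesHeegnerHypothesis (W.conductorNorm ℤ) K → SatisfiesHeegnerHypothesis p K →
      (4 * (W.conductorNorm ℤ : ℤ)) ∣ β ^ 2 - NumberField.discr K → ¬ (p : ℤ) ∣ Dt.c →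
      ∀ (s : ℕ), s ≤ padicValNat p W.tamagawaProduct →
        ∀ (n : ℕ) (d : KolyvaginHeegnerData Dt β ι n), Squarefree n →
          (∀ ℓ ∈ n.primeFactors, Zhang2014.IsKolyvaginPrime (W.conductorNorm ℤ) W K p ℓ ∧
            s ≤ Zhang2014.kolyvaginIndex W p ℓ) → PDiv d p s := by
  intro W _ _ _ p _ K _ _ Dt β ι htam _ _ _ _ _ _ _ _ _ _ _ s hs n d _ _
  have hs0 : s = 0 := by
    rw [padicValNat.eq_zero_of_not_dvd htam] at hs
    exact Nat.le_zero.mp hs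
  subst hs0
  exact Summit.BirchSwinnertonDyer.Rank1Residual.X11b.Three.Koly.pdiv_zero d p

end Summit.BirchSwinnertonDyer.BirchSwinnertonDyer.Theorems

end
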